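import Literature.MathematicalPhysics.QuantumManyBody.BosonicFloor
import Mathlib.MeasureTheory.Integral.Lebesgue.DominatedConvergence
import HarnessLib

/-!
# Crux `OneBodyEntropyBound` (stmt-AtomisticToContinuum-13440), line `registered`: stub `stub_dirichletFloor`

Route `BECCellInformation`, problem `BoseEinsteinCondensation` of the summit `AtomisticToContinuum`;
support file for the line's skeleton (namespace `…Cruxes.OneBodyEntropyBound.Birth`).

**Statement** (`stub_dirichletFloor`, the DIRICHLET BOSONIC FLOOR): for a measurable pair
potential `v : ℝ → ℝ≥0∞` (hard cores allowed), every particle number `N`, every side `L` and EVERY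
`C¹` wave function `f : (ℝ³)^N → ℂ` vanishing off the open box `Λ_L^N` — with no permutation
symmetry whatsoever —
`E₀(N, L) · ∫ |f|² ≤ ∫ (|∇f|² + ∑_{i<j} v(|xᵢ − xⱼ|) |f|²)`,
where `E₀(N, L) = groundStateEnergy v N L` is the infimum of the quadratic form over Bose-SYMMETRIC
normalised `C¹` Dirichlet states: "the bosonic ground-state energy is the absolute ground-state
energy" [LSSY2005, Ch. 2, remark after (2.1)], in unnormalised form.

**Proof** (the torus proof of `BosonicFloor.lean`, transported to the Dirichlet box; no
Perron–Frobenius). Symmetrise the DENSITY, `F = ∑_σ |f ∘ (· ∘ σ)|²` over the `N!` relabellings,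
and regularise its square root, `g_ε = √(ε² + F) − ε` (`ε > 0`). The pointwise facts are those of
`BosonicFloor.lean` / `BosonicFloorSymmetrisation.lean`: `g_ε` is `C¹` and fully symmetric
(`contDiff_sqrtSym`, `sqrtSym_comp_perm`), `|∇g_ε|² ≤ ∑_σ |∇f|² ∘ (· ∘ σ)` (convexity inequality
for gradients, `kineticDensity_sqrtSym_le`) and `g_ε² ≤ F` (`nnnorm_sqrtSym_sq_le`). New here:
* `g_ε` vanishes off `Λ_L^N` (the box is relabelling invariant, so off it every `f (X ∘ σ)`
  vanishes and `g_ε = √(ε²) − ε = 0`; `sqrtSym_eq_zero_of_not_mem_boxN`);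
* the energy density bound with the DIRICHLET interaction `∑_{i<j} v(|xᵢ − xⱼ|)`, which is
  relabelling invariant (`interaction_comp_perm`): `|∇g_ε|² + V g_ε² ≤ ∑_σ (|∇f|² + V|f|²)∘(·∘σ)`;
* whole-space integrals: Lebesgue measure on `(ℝ³)^N` is relabelling invariant
  (`lintegral_comp_perm`), so `𝓔[g_ε] ≤ N! 𝓔[f]` and `‖g_ε‖² ≤ N! ‖f‖²`, and
  `‖g_{1/(n+1)}‖² → N! ‖f‖²` by dominated convergence (`‖f‖² < ∞`: `f` is continuous and
  vanishes off the bounded box, `lintegral_boxN_normSq_lt_top`);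
* the variational principle for the unnormalised symmetric Dirichlet function `g_ε`
  (`groundStateEnergy_mul_normSq_le`): `E₀ ‖g_ε‖² ≤ 𝓔[g_ε] ≤ N! 𝓔[f]`; let `ε → 0` and cancel
  `N!` (if `‖f‖² = 0` there is nothing to prove; `E₀ = ⊤` is allowed throughout).
Edge cases need no separate treatment: `N = 0` (`0! = 1`), `L ≤ 0` (`f ≡ 0`).
-/

noncomputable section

namespace Summit.AtomisticToContinuum.BoseEinsteinCondensation.Cruxes.OneBodyEntropyBound.Birth

open MeasureTheory Filter Topology
open scoped ENNReal NNReal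
open Literature.MathematicalPhysics.QuantumManyBody.BoseGas

namespace DirichletFloor

variable {N : ℕ} {L : ℝ} {f : Config N → ℂ} {ε : ℝ}

/-- The `N`-particle box `Λ_L^N` is relabelling invariant: `X ∘ σ ∈ Λ_L^N ↔ X ∈ Λ_L^N`. [folklore] -/
theorem comp_perm_mem_boxN_iff (σ : Equiv.Perm (Fin N)) (X : Config N) :
    X ∘ σ ∈ boxN N L ↔ X ∈ boxN N L :=
  σ.forall_congr_right (q := fun i => X i ∈ box L)

/-- `g_ε = √(ε² + ∑_σ |f ∘ (· ∘ σ)|²) − ε` vanishes off the box when `f` does (`ε ≥ 0`): off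
`Λ_L^N` every relabelled copy `f (X ∘ σ)` vanishes, so `g_ε(X) = √(ε²) − ε = 0`. [folklore] -/
theorem sqrtSym_eq_zero_of_not_mem_boxN (h0 : ∀ X, X ∉ boxN N L → f X = 0) (hε : 0 ≤ ε)
    (X : Config N) (hX : X ∉ boxN N L) :
    ((Real.sqrt (ε ^ 2 + ∑ σ : Equiv.Perm (Fin N), ‖f (X ∘ σ)‖ ^ 2) - ε : ℝ) : ℂ) = 0 := by
  have h : ∀ σ : Equiv.Perm (Fin N), f (X ∘ σ) = 0 :=
    fun σ => h0 _ fun hσ => hX ((comp_perm_mem_boxN_iff σ X).1 hσ)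
  simp only [h, norm_zero, ne_eq, OfNat.ofNat_ne_zero, not_false_eq_true, zero_pow,
    Finset.sum_const_zero, add_zero, Real.sqrt_sq hε, sub_self, Complex.ofReal_zero]

/-- **Pointwise energy-density bound (Dirichlet interaction)**:
`|∇g_ε|² + V g_ε² ≤ ∑_σ (|∇f|² + V |f|²) ∘ (· ∘ σ)` with `V = ∑_{i<j} v(|xᵢ − xⱼ|)`, by the convexity
inequality for gradients (`kineticDensity_sqrtSym_le`), `g_ε² ≤ ∑_σ |f ∘ σ|²` and the relabelling
invariance of the interaction (`interaction_comp_perm`). [cite: LiebLoss2001, Thm. 7.8] -/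
theorem energyDensity_sqrtSym_le_interaction (hf : ContDiff ℝ 1 f) (hε : 0 < ε) (v : ℝ → ℝ≥0∞)
    (X : Config N) :
    kineticDensity (fun Y : Config N =>
        ((Real.sqrt (ε ^ 2 + ∑ σ : Equiv.Perm (Fin N), ‖f (Y ∘ σ)‖ ^ 2) - ε : ℝ) : ℂ)) X +
        interaction v X *
          ((‖((Real.sqrt (ε ^ 2 + ∑ σ : Equiv.Perm (Fin N), ‖f (X ∘ σ)‖ ^ 2) - ε : ℝ) : ℂ)‖₊ :
            ℝ≥0∞)) ^ 2 ≤
      ∑ σ : Equiv.Perm (Fin N), (kineticDensity f (X ∘ σ) +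
        interaction v (X ∘ σ) * ((‖f (X ∘ σ)‖₊ : ℝ≥0∞)) ^ 2) := by
  rw [Finset.sum_add_distrib]
  refine add_le_add (kineticDensity_sqrtSym_le hf hε X) ?_
  calc interaction v X *
        ((‖((Real.sqrt (ε ^ 2 + ∑ σ : Equiv.Perm (Fin N), ‖f (X ∘ σ)‖ ^ 2) - ε : ℝ) : ℂ)‖₊ :
          ℝ≥0∞)) ^ 2
      ≤ interaction v X * ∑ σ : Equiv.Perm (Fin N), ((‖f (X ∘ σ)‖₊ : ℝ≥0∞)) ^ 2 :=
        mul_le_mul_right (nnnorm_sqrtSym_sq_le f hε X) _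
    _ = ∑ σ : Equiv.Perm (Fin N), interaction v (X ∘ σ) * ((‖f (X ∘ σ)‖₊ : ℝ≥0∞)) ^ 2 := by
        rw [Finset.mul_sum]
        simp only [interaction_comp_perm]

/-- **Energy of the regularised symmetrised modulus (whole space)**: for measurable `v`,
`∫ (|∇g_ε|² + V g_ε²) ≤ N! · ∫ (|∇f|² + V |f|²)` — each of the `N!` relabelled copies has the energy
of `f`, by the relabelling invariance of Lebesgue measure on `(ℝ³)^N` (`lintegral_comp_perm`).
[folklore] -/
theorem lintegral_energyDensity_sqrtSym_le_interaction {v : ℝ → ℝ≥0∞} (hv : Measurable v)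
    (hf : ContDiff ℝ 1 f) (hε : 0 < ε) :
    ∫⁻ X, (kineticDensity (fun Y : Config N =>
        ((Real.sqrt (ε ^ 2 + ∑ σ : Equiv.Perm (Fin N), ‖f (Y ∘ σ)‖ ^ 2) - ε : ℝ) : ℂ)) X +
        interaction v X *
          ((‖((Real.sqrt (ε ^ 2 + ∑ σ : Equiv.Perm (Fin N), ‖f (X ∘ σ)‖ ^ 2) - ε : ℝ) : ℂ)‖₊ :
            ℝ≥0∞)) ^ 2) ≤
      (Fintype.card (Equiv.Perm (Fin N)) : ℝ≥0∞) *
        ∫⁻ X, (kineticDensity f X + interaction v X * ((‖f X‖₊ : ℝ≥0∞)) ^ 2) := by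
  set Φ : Config N → ℝ≥0∞ := fun X =>
    kineticDensity f X + interaction v X * ((‖f X‖₊ : ℝ≥0∞)) ^ 2 with hΦ_def
  have hΦ : Measurable Φ := (measurable_kineticDensity hf).add
    ((measurable_interaction hv).mul (measurable_normSq hf.continuous))
  calc ∫⁻ X, (kineticDensity (fun Y : Config N =>
        ((Real.sqrt (ε ^ 2 + ∑ σ : Equiv.Perm (Fin N), ‖f (Y ∘ σ)‖ ^ 2) - ε : ℝ) : ℂ)) X +
          interaction v X *
            ((‖((Real.sqrt (ε ^ 2 + ∑ σ : Equiv.Perm (Fin N), ‖f (X ∘ σ)‖ ^ 2) - ε : ℝ) : ℂ)‖₊ :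
              ℝ≥0∞)) ^ 2)
      ≤ ∫⁻ X, ∑ σ : Equiv.Perm (Fin N), Φ (X ∘ σ) :=
        lintegral_mono fun X => energyDensity_sqrtSym_le_interaction hf hε v X
    _ = ∑ σ : Equiv.Perm (Fin N), ∫⁻ X, Φ (X ∘ σ) :=
        lintegral_finsetSum _ fun σ _ => hΦ.comp (measurable_comp_perm_config σ)
    _ = ∑ σ : Equiv.Perm (Fin N), ∫⁻ X, Φ X :=
        Finset.sum_congr rfl fun σ _ => lintegral_comp_perm σ Φ
    _ = (Fintype.card (Equiv.Perm (Fin N)) : ℝ≥0∞) * ∫⁻ X, Φ X := by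
        rw [Finset.sum_const, Finset.card_univ, nsmul_eq_mul]

/-- `∫ ∑_σ ‖f(X ∘ σ)‖₊² = N! · ∫ ‖f‖₊²` on `(ℝ³)^N` (relabelling invariance of Lebesgue measure).
[folklore] -/
theorem lintegral_sum_nnnorm_comp_perm_sq_volume (hf : Continuous f) :
    ∫⁻ X, ∑ σ : Equiv.Perm (Fin N), ((‖f (X ∘ σ)‖₊ : ℝ≥0∞)) ^ 2 =
      (Fintype.card (Equiv.Perm (Fin N)) : ℝ≥0∞) * ∫⁻ X, ((‖f X‖₊ : ℝ≥0∞)) ^ 2 := by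
  have hmeas : ∀ σ : Equiv.Perm (Fin N),
      Measurable fun X : Config N => ((‖f (X ∘ σ)‖₊ : ℝ≥0∞)) ^ 2 :=
    fun σ => (measurable_normSq hf).comp (measurable_comp_perm_config σ)
  rw [lintegral_finsetSum _ fun σ _ => hmeas σ]
  calc ∑ σ : Equiv.Perm (Fin N), ∫⁻ X, ((‖f (X ∘ σ)‖₊ : ℝ≥0∞)) ^ 2
      = ∑ σ : Equiv.Perm (Fin N), ∫⁻ X, ((‖f X‖₊ : ℝ≥0∞)) ^ 2 :=
        Finset.sum_congr rfl fun σ _ =>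
          lintegral_comp_perm σ (fun X => ((‖f X‖₊ : ℝ≥0∞)) ^ 2)
    _ = (Fintype.card (Equiv.Perm (Fin N)) : ℝ≥0∞) * ∫⁻ X, ((‖f X‖₊ : ℝ≥0∞)) ^ 2 := by
        rw [Finset.sum_const, Finset.card_univ, nsmul_eq_mul]

/-- `∫ ‖g_ε‖₊² ≤ N! · ∫ ‖f‖₊²` on `(ℝ³)^N` (from `g_ε² ≤ ∑_σ |f ∘ σ|²`). [folklore] -/
theorem lintegral_nnnorm_sqrtSym_sq_le_volume (hf : Continuous f) (hε : 0 < ε) :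
    ∫⁻ X, ((‖((Real.sqrt (ε ^ 2 + ∑ σ : Equiv.Perm (Fin N), ‖f (X ∘ σ)‖ ^ 2) - ε : ℝ) : ℂ)‖₊ :
        ℝ≥0∞)) ^ 2 ≤
      (Fintype.card (Equiv.Perm (Fin N)) : ℝ≥0∞) * ∫⁻ X, ((‖f X‖₊ : ℝ≥0∞)) ^ 2 := by
  rw [← lintegral_sum_nnnorm_comp_perm_sq_volume hf]
  exact lintegral_mono fun X => nnnorm_sqrtSym_sq_le f hε X

/-- **The regularised symmetrised modulus as a bosonic Dirichlet trial function**: for measurable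
`v`, a `C¹` function `f` vanishing off `Λ_L^N` and `ε > 0`,
`E₀(N, L) · ∫ g_ε² ≤ N! · ∫ (|∇f|² + V |f|²)` — `g_ε` is `C¹`, symmetric and vanishes off the box,
so the unnormalised Dirichlet variational principle `groundStateEnergy_mul_normSq_le` applies.
[cite: LSSY2005, Ch. 2 (bosons: remark after (2.1))] -/
theorem groundStateEnergy_mul_lintegral_sqrtSym_le {v : ℝ → ℝ≥0∞} (hv : Measurable v)
    (hf : ContDiff ℝ 1 f) (h0 : ∀ X, X ∉ boxN N L → f X = 0) (hε : 0 < ε) :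
    groundStateEnergy v N L * ∫⁻ X,
        ((‖((Real.sqrt (ε ^ 2 + ∑ σ : Equiv.Perm (Fin N), ‖f (X ∘ σ)‖ ^ 2) - ε : ℝ) : ℂ)‖₊ :
          ℝ≥0∞)) ^ 2 ≤
      (Fintype.card (Equiv.Perm (Fin N)) : ℝ≥0∞) *
        ∫⁻ X, (kineticDensity f X + interaction v X * ((‖f X‖₊ : ℝ≥0∞)) ^ 2) :=
  (groundStateEnergy_mul_normSq_le v (contDiff_sqrtSym hf hε)
    (fun X hX => sqrtSym_eq_zero_of_not_mem_boxN h0 hε.le X hX)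
    (fun σ X => sqrtSym_comp_perm f ε σ X)).trans
    (lintegral_energyDensity_sqrtSym_le_interaction hv hf hε)

/-- **Removing the regularisation (whole space)**: `∫ g_{1/(n+1)}² → N! · ∫ |f|²` as `n → ∞` when
`∫ |f|² < ∞` (dominated convergence: `g_ε² ≤ ∑_σ |f ∘ σ|²`, integrable, and `g_ε² → ∑_σ |f ∘ σ|²`
pointwise, `tendsto_sqrtReg_sq`). [folklore] -/
theorem tendsto_lintegral_nnnorm_sqrtSym_sq_volume (hf : ContDiff ℝ 1 f)
    (htop : ∫⁻ X, ((‖f X‖₊ : ℝ≥0∞)) ^ 2 ≠ ⊤) :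
    Tendsto (fun n : ℕ => ∫⁻ X,
        ((‖((Real.sqrt ((1 / ((n : ℝ) + 1)) ^ 2 + ∑ σ : Equiv.Perm (Fin N), ‖f (X ∘ σ)‖ ^ 2) -
          (1 / ((n : ℝ) + 1)) : ℝ) : ℂ)‖₊ : ℝ≥0∞)) ^ 2)
      atTop
      (𝓝 ((Fintype.card (Equiv.Perm (Fin N)) : ℝ≥0∞) * ∫⁻ X, ((‖f X‖₊ : ℝ≥0∞)) ^ 2)) := by
  rw [← lintegral_sum_nnnorm_comp_perm_sq_volume hf.continuous]
  refine tendsto_lintegral_of_dominated_convergence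
    (fun X => ∑ σ : Equiv.Perm (Fin N), ((‖f (X ∘ σ)‖₊ : ℝ≥0∞)) ^ 2) (fun n => ?_) (fun n => ?_)
    ?_ ?_
  · exact measurable_normSq (contDiff_sqrtSym hf Nat.one_div_pos_of_nat).continuous
  · exact ae_of_all _ fun X => nnnorm_sqrtSym_sq_le f Nat.one_div_pos_of_nat X
  · rw [lintegral_sum_nnnorm_comp_perm_sq_volume hf.continuous]
    exact ENNReal.mul_ne_top (ENNReal.natCast_ne_top _) htop
  · refine ae_of_all _ fun X => ?_
    have h0 : 0 ≤ ∑ σ : Equiv.Perm (Fin N), ‖f (X ∘ σ)‖ ^ 2 := by positivity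
    have h := ENNReal.tendsto_ofReal (tendsto_sqrtReg_sq h0)
    rw [ofReal_sum_norm_sq (fun (σ : Equiv.Perm (Fin N)) (Y : Config N) => f (Y ∘ σ)) X] at h
    refine h.congr fun n => ?_
    exact (nnnorm_ofReal_sqrtReg_sq_eq
      (fun (σ : Equiv.Perm (Fin N)) (Y : Config N) => f (Y ∘ σ)) X _).symm

/-- **The bosonic ground-state energy is the absolute one (Dirichlet box), unnormalised form.**
For a measurable pair potential `v ≥ 0` (hard cores allowed) and EVERY `C¹` wave function `f` of
`N` particles vanishing off the open box `Λ_L^N` — with no permutation symmetry whatsoever —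
`E₀(N, L) · ∫ |f|² ≤ ∫ (|∇f|² + ∑_{i<j} v(|xᵢ − xⱼ|) |f|²)`. Proof without Perron–Frobenius: the
symmetrised, regularised modulus `g_ε = √(ε² + ∑_σ |f ∘ σ|²) − ε` is an admissible bosonic
Dirichlet function with `E₀ · ‖g_ε‖² ≤ N! · 𝓔[f]` (`groundStateEnergy_mul_lintegral_sqrtSym_le`),
and `‖g_ε‖² → N! ‖f‖²` as `ε → 0` (`‖f‖² < ∞` since `f` is continuous and vanishes off the bounded
box). [cite: LSSY2005, Ch. 2 (bosons: remark after (2.1))] -/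
theorem groundStateEnergy_mul_lintegral_le {v : ℝ → ℝ≥0∞} (hv : Measurable v)
    (hf : ContDiff ℝ 1 f) (h0 : ∀ X, X ∉ boxN N L → f X = 0) :
    groundStateEnergy v N L * ∫⁻ X, ((‖f X‖₊ : ℝ≥0∞)) ^ 2 ≤
      ∫⁻ X, (kineticDensity f X + interaction v X * ((‖f X‖₊ : ℝ≥0∞)) ^ 2) := by
  set E := ∫⁻ X, (kineticDensity f X + interaction v X * ((‖f X‖₊ : ℝ≥0∞)) ^ 2) with hE
  set E₀ := groundStateEnergy v N L with hE₀
  set c : ℝ≥0∞ := (Fintype.card (Equiv.Perm (Fin N)) : ℝ≥0∞) with hc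
  have hc0 : c ≠ 0 := Nat.cast_ne_zero.2 Fintype.card_ne_zero
  have hctop : c ≠ ⊤ := ENNReal.natCast_ne_top _
  -- `‖f‖² < ∞`: `f` is continuous and vanishes off the bounded box
  have hsup : Function.support (fun X => ((‖f X‖₊ : ℝ≥0∞)) ^ 2) ⊆ boxN N L := by
    intro X hX
    by_contra h
    exact hX (by simp [h0 X h])
  have hmtop : ∫⁻ X, ((‖f X‖₊ : ℝ≥0∞)) ^ 2 ≠ ⊤ := by
    rw [← setLIntegral_eq_of_support_subset hsup]
    exact (lintegral_boxN_normSq_lt_top hf.continuous L).ne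
  set m := ∫⁻ X, ((‖f X‖₊ : ℝ≥0∞)) ^ 2 with hm
  rcases eq_or_ne m 0 with hm0 | hm0
  · simp [hm0]
  have hlim : Tendsto (fun n : ℕ => E₀ * ∫⁻ X,
      ((‖((Real.sqrt ((1 / ((n : ℝ) + 1)) ^ 2 + ∑ σ : Equiv.Perm (Fin N), ‖f (X ∘ σ)‖ ^ 2) -
        (1 / ((n : ℝ) + 1)) : ℝ) : ℂ)‖₊ : ℝ≥0∞)) ^ 2) atTop (𝓝 (E₀ * (c * m))) :=
    ENNReal.Tendsto.const_mul (tendsto_lintegral_nnnorm_sqrtSym_sq_volume hf hmtop)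
      (Or.inl (mul_ne_zero hc0 hm0))
  have hle : E₀ * (c * m) ≤ c * E :=
    le_of_tendsto' hlim fun n =>
      groundStateEnergy_mul_lintegral_sqrtSym_le hv hf h0 Nat.one_div_pos_of_nat
  calc E₀ * m = E₀ * m * c / c := (ENNReal.mul_div_cancel_right hc0 hctop).symm
    _ = E₀ * (c * m) / c := by rw [mul_assoc, mul_comm m c]
    _ ≤ c * E / c := ENNReal.div_le_div_right hle c
    _ = E := by rw [mul_comm, ENNReal.mul_div_cancel_right hc0 hctop]

end DirichletFloor

/-- **Stub `stub_dirichletFloor` (Dirichlet bosonic floor).** The infimum `groundStateEnergy v N L`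
of the quadratic form over Bose-symmetric normalised `C¹` Dirichlet states is below the quadratic
form of every `C¹` function vanishing off the box, symmetric or not, in unnormalised form:
`E₀(N, L) · ∫ |f|² ≤ ∫ (|∇f|² + ∑_{i<j} v(|xᵢ − xⱼ|) |f|²)`
(`DirichletFloor.groundStateEnergy_mul_lintegral_le`). [cite: LSSY2005, Ch. 2 (bosons: remark after (2.1))] -/
theorem stub_dirichletFloor :
    ∀ (N : ℕ) (L : ℝ) (v : ℝ → ENNReal), Measurable v →
      ∀ f : Literature.MathematicalPhysics.QuantumManyBody.BoseGas.Config N → ℂ, ContDiff ℝ 1 f →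
        (∀ X, X ∉ Literature.MathematicalPhysics.QuantumManyBody.BoseGas.boxN N L → f X = 0) →
        Literature.MathematicalPhysics.QuantumManyBody.BoseGas.groundStateEnergy v N L *
            ∫⁻ X, (‖f X‖₊ : ENNReal) ^ 2 ≤
          ∫⁻ X, (Literature.MathematicalPhysics.QuantumManyBody.BoseGas.kineticDensity f X +
            Literature.MathematicalPhysics.QuantumManyBody.BoseGas.interaction v X * (‖f X‖₊ : ENNReal) ^ 2) :=
  fun _N _L _v hv _f hf h0 => DirichletFloor.groundStateEnergy_mul_lintegral_le hv hf h0

end Summit.AtomisticToContinuum.BoseEinsteinCondensation.Cruxes.OneBodyEntropyBound.Birth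

end
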